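import Literature.NumberTheory.GelbartRogawski1991.FiniteAdelicSplittingAssembly
import Literature.NumberTheory.GelbartRogawski1991.RationalSymplecticUnramifiedVector
import Literature.NumberTheory.GelbartRogawski1991.FiniteAdelicRationalImplementer
import Literature.NumberTheory.GelbartRogawski1991.DoubledUnitarySiegelPlaceComponentsGen
import Literature.NumberTheory.GelbartRogawski1991.DoubledUnitarySiegelParabolicAlgebraGen
import HarnessLib

/-!
#  The finite half of the doubled Weil representation from the per-place package — general `E/F`

General-quadratic-extension twin (namespace `GRConstructionGen`) of `DoubledWeilRepresentationFiniteHalf` (CM case,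
namespace `GRConstruction`): the CM field `L ⊃ L⁺` with complex conjugation and `realDiagonal` Gram data is replaced by an
arbitrary quadratic extension `E/F` of number fields with `c ∈ Aut(E/F)`, `c δ = -δ ≠ 0`, `δ² = d ∈ F`, and symmetric
invertible Gram matrices `TV`, `TW` over `F` (objects of `DoubledUnitaryGlobalSplittingDataGen`).  Statements and proofs are
verbatim transports.

[GelbartRogawski1991, §3.1 Prop. 3.1.1] by doubling, finite places: from a `FinLocalFamily χ 𝔪` of
`DoubledUnitaryGlobalSplittingData` (at every finite place `v` of `L⁺` a Lagrangian, a `LocalSplittingDatum` at the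
doubled data, the local parabolic normalisation `ParabolicNormalisedAt v`, and the unramified clause for almost all
`v`) the restricted tensor product `s_f := ⊗'_v s_v : H(𝔸_f) →* Mp(𝕎^𝔻)ᶜᵒⁿᵗ` of the tree's
`FiniteAdelicSplittingAssembly.finSplitting` is a FINITE HALF: `IsFinHalf χ s_f` (`finHalf_isFinHalf`, `S1fin_asm`).
The parabolic prescription on `P_Δ(𝔸_f)` is transferred from the local prescriptions by the tree's origin-value
transfer `FiniteAdelicRationalImplementer.conjOp_apply_zero` [Weil1964, n° 37–40], applied to the implementers
`c_v⁻¹ r_v(δ_v)` of the rational element `δ` normalised to fix `1_{𝒪_vᴺ}` almost everywhere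
(`RationalSymplecticUnramifiedVector.eventually_exists_smul_unitVec`), with the continuity of
`g ↦ χ(det_Δ g)|det_Δ g|^{1/2}` on the Siegel set of `H(𝔸_f)` (§(a)) and the placewise description of that set (§(b),
`DoubledUnitarySiegelPlaceComponents`).
-/

set_option autoImplicit false

noncomputable section

open scoped Classical
open scoped Matrix Kronecker TensorProduct
open NumberField IsDedekindDomain
open Literature.RepresentationTheory.HeisenbergGroup
open Literature.NumberTheory.Automorphic
open Literature.NumberTheory.Weil1964
open Literature.NumberTheory.GaloisRepresentations

namespace Literature.NumberTheory.GelbartRogawski1991.GRConstructionGen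

open UnitaryDualPair

variable (F : Type) [Field F] [NumberField F] (E : Type) [Field E] [NumberField E] [Algebra F E]
  [Algebra.IsQuadraticExtension F E]
variable (c : E ≃ₐ[F] E) {δ : E} (hcδ : c δ = -δ) (hδ : δ ≠ 0) {d : F} (hd : δ * δ = algebraMap F E d)
variable {N M n : ℕ} (e : Fin N × Fin M ≃ Fin n)
  (TV : Matrix (Fin N) (Fin N) F) (hV : TV.IsSymm) (hVd : IsUnit TV.det)
  (TW : Matrix (Fin M) (Fin M) F) (hW : TW.IsSymm) (hWd : IsUnit TW.det)

section S1finAsm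

open Literature.NumberTheory.GelbartRogawski1991.UnitaryDualPair.LocalSplitting MeasureTheory

local notation "LocPi'" => UnitaryGroup.localPi E c (n + n) (hermD F E e TV TW)
local notation "HAf'" => UnitaryGroup.finAdelic F E c (n + n) (hermD F E e TV TW)
local notation "finToA'" => UnitaryGroup.finAdelicToAdelic F E c (n + n) (hermD F E e TV TW)
local notation "inclP'" => UnitaryGroup.inclPlace F E c (n + n) (hermD F E e TV TW)
local notation "evalP'" => UnitaryGroup.evalPlace F E c (n + n) (hermD F E e TV TW)

/-! ##### (a) continuity of `det_Δ` and of the prescribed scalar on the Siegel set of `H(𝔸_f)` -/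

omit [NumberField F] [Algebra.IsQuadraticExtension F E] in
/-- `h ↦ det_Δ h` is continuous on `H(𝔸)` (a polynomial in the matrix entries).
[cite: GelbartRogawski1991, §3.1 Prop. 3.1.1 p. 455 L1–2] -/
theorem continuous_detDelta : Continuous (detDelta F E c e TV TW) := by
  have hval : Continuous fun h : HA F E c e TV TW =>
      ((h : GL (Fin (n + n)) (AdeleRing (𝓞 E) E)) : Matrix (Fin (n + n)) (Fin (n + n)) (AdeleRing (𝓞 E) E)) :=
    Units.continuous_val.comp continuous_subtype_val
  have hblk : Continuous (blk F E c e TV TW) :=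
    continuous_matrix fun i j => hval.matrix_elem ((e₂ (n := n)) i) ((e₂ (n := n)) j)
  unfold detDelta deltaBlock
  refine Continuous.matrix_det (Continuous.add ?_ ?_)
  · exact continuous_matrix fun i j => hblk.matrix_elem _ _
  · exact continuous_matrix fun i j => hblk.matrix_elem _ _

/-- the Siegel set `{g ∈ H(𝔸_f) | (1, g) ∈ P_Δ(𝔸)}`. [cite: GelbartRogawski1991, §3.1 Prop. 3.1.1 p. 455 L1–2] -/
def siegelSetFin : Set HAf' := {g | IsSiegelDelta F E c e TV TW (finToA' g)}

omit [Algebra.IsQuadraticExtension F E] in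
/-- membership. [cite: GelbartRogawski1991, §3.1 Prop. 3.1.1 p. 455 L1–2] -/
theorem mem_siegelSetFin_iff (g : HAf') :
    g ∈ siegelSetFin F E c e TV TW ↔ IsSiegelDelta F E c e TV TW (finToA' g) := Iff.rfl

omit [Algebra.IsQuadraticExtension F E] in
/-- the unit `det_Δ(finToA g)` for `g` in the Siegel set, as a CONTINUOUS map into the ideles.
[cite: GelbartRogawski1991, §3.1 Prop. 3.1.1 p. 455 L1–2] -/
theorem continuousOn_unit_detDelta (U : HAf' → ideleGroup E)
    (hU : ∀ g, IsSiegelDelta F E c e TV TW (finToA' g) → (U g : AdeleRing (𝓞 E) E) = detDelta F E c e TV TW (finToA' g)) :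
    ContinuousOn U (siegelSetFin F E c e TV TW) := by
  rw [continuousOn_iff_continuous_restrict]
  refine Units.continuous_iff.2 ⟨?_, ?_⟩
  · have h : (fun g : siegelSetFin F E c e TV TW => ((U (g : HAf') : ideleGroup E) : AdeleRing (𝓞 E) E)) =
        fun g : siegelSetFin F E c e TV TW => detDelta F E c e TV TW (finToA' (g : HAf')) := funext fun g => hU (g : HAf') g.2
    change Continuous fun g : siegelSetFin F E c e TV TW => ((U (g : HAf') : ideleGroup E) : AdeleRing (𝓞 E) E)
    rw [h]
    exact (continuous_detDelta F E c e TV TW).comp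
      ((UnitaryGroup.continuous_finAdelicToAdelic F E c (n + n) (hermD F E e TV TW)).comp
        continuous_subtype_val)
  · have h : (fun g : siegelSetFin F E c e TV TW => ((U (g : HAf'))⁻¹ : ideleGroup E).val) =
        fun g : siegelSetFin F E c e TV TW => detDelta F E c e TV TW (finToA' (g : HAf')⁻¹) := funext fun g => by
      have e1 : ((U (g : HAf'))⁻¹ : ideleGroup E).val * detDelta F E c e TV TW (finToA' (g : HAf')) = 1 := by
        rw [← hU (g : HAf') g.2, Units.inv_mul]
      have e2 : detDelta F E c e TV TW (finToA' (g : HAf')) * detDelta F E c e TV TW (finToA' (g : HAf')⁻¹) = 1 := by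
        rw [map_inv]; exact detDelta_mul_inv F E c e TV TW g.2
      calc ((U (g : HAf'))⁻¹ : ideleGroup E).val
          = ((U (g : HAf'))⁻¹ : ideleGroup E).val * (detDelta F E c e TV TW (finToA' (g : HAf')) *
              detDelta F E c e TV TW (finToA' (g : HAf')⁻¹)) := by rw [e2, mul_one]
        _ = detDelta F E c e TV TW (finToA' (g : HAf')⁻¹) := by rw [← mul_assoc, e1, one_mul]
    change Continuous fun g : siegelSetFin F E c e TV TW => ((U (g : HAf'))⁻¹ : ideleGroup E).val
    rw [h]
    exact (continuous_detDelta F E c e TV TW).comp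
      ((UnitaryGroup.continuous_finAdelicToAdelic F E c (n + n) (hermD F E e TV TW)).comp
        (continuous_inv.comp continuous_subtype_val))

omit [Algebra.IsQuadraticExtension F E] in
/-- **`g ↦ χ(det_Δ g) · |det_Δ g|^{1/2}` is continuous on the Siegel set of `H(𝔸_f)`.**
[cite: GelbartRogawski1991, §3.1 Prop. 3.1.1 p. 455 L1–2] -/
theorem continuousOn_chiDet_modDelta (χ : HeckeCharacter E) :
    ContinuousOn (fun g : HAf' => ((chiDet F E c e TV TW χ (finToA' g) : ℂˣ) : ℂ) * (modDelta F E c e TV TW (finToA' g) : ℂ))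
      (siegelSetFin F E c e TV TW) := by
  -- the unit selector
  let U : HAf' → ideleGroup E := fun g =>
    if h : IsSiegelDelta F E c e TV TW (finToA' g) then (isUnit_detDelta_of_isSiegelDelta F E c e TV TW _ h).unit else 1
  have hU : ∀ g, IsSiegelDelta F E c e TV TW (finToA' g) → (U g : AdeleRing (𝓞 E) E) = detDelta F E c e TV TW (finToA' g) :=
    fun g h => by simp only [U, dif_pos h, IsUnit.unit_spec]
  have hUc := continuousOn_unit_detDelta F E c e TV TW U hU
  have hchi : ∀ g, IsSiegelDelta F E c e TV TW (finToA' g) → chiDet F E c e TV TW χ (finToA' g) = χ (U g) := fun g h => by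
    have hu := isUnit_detDelta_of_isSiegelDelta F E c e TV TW _ h
    unfold chiDet
    rw [dif_pos hu]
    congr 1
    exact Units.ext (by rw [IsUnit.unit_spec, hU g h])
  have hmod : ∀ g, IsSiegelDelta F E c e TV TW (finToA' g) →
      modDelta F E c e TV TW (finToA' g) = Real.sqrt (ideleNorm (U g)) := fun g h => by
    have hu := isUnit_detDelta_of_isSiegelDelta F E c e TV TW _ h
    unfold modDelta
    rw [dif_pos hu]
    congr 2
    exact Units.ext (by rw [IsUnit.unit_spec, hU g h])
  have hnorm : Continuous fun x : ideleGroup E => ideleNorm x := by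
    have h := (NNReal.continuous_coe.comp (continuous_ideleNorm_holds E))
    refine h.congr fun x => ?_
    exact coe_ideleNorm E x
  refine ContinuousOn.mul ?_ ?_
  · have h1 : ContinuousOn (fun g : HAf' => ((χ (U g) : ℂˣ) : ℂ)) (siegelSetFin F E c e TV TW) :=
      (Units.continuous_val.comp (map_continuous χ)).comp_continuousOn hUc
    exact h1.congr fun g hg => by simp only [hchi g hg]
  · have h2 : ContinuousOn (fun g : HAf' => ((Real.sqrt (ideleNorm (U g)) : ℝ) : ℂ)) (siegelSetFin F E c e TV TW) :=
      (Complex.continuous_ofReal.comp (Real.continuous_sqrt.comp hnorm)).comp_continuousOn hUc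
    exact h2.congr fun g hg => by simp only [hmod g hg]

/-! ##### (b) the Siegel set of `H(𝔸_f)` place by place -/

omit [Algebra.IsQuadraticExtension F E] in
/-- `finToA g ∈ P_Δ(𝔸) ↔ ι_v(g_v) ∈ P_Δ(𝔸)` for every finite place `v`.
[cite: GelbartRogawski1991, §3.1 Prop. 3.1.1 p. 455 L1–2] -/
theorem isSiegelDelta_finToA_iff_forall_place (g : HAf') :
    IsSiegelDelta F E c e TV TW (finToA' g) ↔ ∀ v, IsSiegelDelta F E c e TV TW (locToAdelic F E c e TV TW v (evalP' v g)) := by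
  rw [isSiegelDelta_finAdelicToAdelic_iff, isSiegelM_iff_forall_place]
  refine ⟨fun h v => (isSiegelDelta_locToAdelic_iff F E c e TV TW v _).2 fun w => ?_, fun h w => ?_⟩
  · have hw := h w.1
    rwa [UnitaryGroup.map_eval_eq_evalAt] at hw
  · have hv := (isSiegelDelta_locToAdelic_iff F E c e TV TW (w.under (𝓞 F)) _).1 (h (w.under (𝓞 F))) ⟨w, rfl⟩
    rw [UnitaryGroup.map_eval_eq_evalAt]
    exact hv
/-! ##### (c) the family of local splittings of the per-place package, in the shape `FinLocalSplittings` -/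

section Family

variable (χ : HeckeCharacter E) (𝔪 : ∀ v, PlaceMeasure F v) (𝓕 : FinLocalFamily F E c hcδ hδ hd e TV hV hVd TW hW hWd χ 𝔪)

/-- the local splitting of the family at `v` (instances unbundled from `𝔪 v`).
[cite: GelbartRogawski1991, §3.1 Prop. 3.1.1 p. 455 L1–2] -/
def localSplittingAt (v : HeightOneSpectrum (𝓞 F)) :
    LocPi' v →* LocalMp F (n + n) (gramD F e TV TW) v := by
  letI := (𝔪 v).mS; haveI := (𝔪 v).isBorel; haveI := (𝔪 v).isHaar
  exact LocalSplittingDatum.localSplitting (𝓕.𝓓 v)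

include 𝓕 in
/-- implementers are unique up to scalars on every local smooth Schrödinger model (the datum's field `hU`).
[cite: GelbartRogawski1991, §3.1 Prop. 3.1.1 p. 455 L1–2] -/
theorem hU_family (v : HeightOneSpectrum (𝓞 F)) :
    ImplementerUniqueUpToScalar (localSchrodinger F (n + n) (gramD F e TV TW) v) := by
  letI := (𝔪 v).mS; haveI := (𝔪 v).isBorel; haveI := (𝔪 v).isHaar
  exact (𝓕.𝓓 v).hU

/-- **the family as a `FinLocalSplittings`** (tree `FiniteAdelicSplittingAssembly`): `s v := (𝓓 v).localSplitting`, over `ι_v`, smooth, unramified a.e.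
[cite: GelbartRogawski1991, §3.1 Prop. 3.1.1 p. 455 L1–2] -/
def finSplittings : FinLocalSplittings F E c (n + n) hcδ hδ
    hd (gramD F e TV TW) (gramD_isSymm F e TV hV TW hW) (J := hermD F E e TV TW) rfl where
  s v := localSplittingAt F E c hcδ hδ hd e TV hV hVd TW hW hWd χ 𝔪 𝓕 v
  proj_s v g := by
    letI := (𝔪 v).mS; haveI := (𝔪 v).isBorel; haveI := (𝔪 v).isHaar
    exact LocalSplittingDatum.proj_localSplitting (𝓕.𝓓 v) g
  smooth v := by
    letI := (𝔪 v).mS; haveI := (𝔪 v).isBorel; haveI := (𝔪 v).isHaar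
    intro Φ
    obtain ⟨U, hU, hfix⟩ := (𝓕.𝓓 v).smooth Φ
    refine Representation.isSmoothVector_of_le _ hU fun k hk => ?_
    rw [Representation.mem_stabilizerSubgroup]
    change LocalSplittingDatum.localOmega (𝓕.𝓓 v) k Φ = Φ
    rw [LocalSplittingDatum.localOmega_apply]
    exact hfix k hk
  unramified := 𝓕.unramified

/-- the local Weil representation of the family is `omegaAt`.
[cite: GelbartRogawski1991, §3.1 Prop. 3.1.1 p. 455 L1–2] -/
theorem omegaLoc_finSplittings (v : HeightOneSpectrum (𝓞 F)) :
    (finSplittings F E c hcδ hδ hd e TV hV hVd TW hW hWd χ 𝔪 𝓕).omegaLoc v = omegaAt F E c hcδ hδ hd e TV hV hVd TW hW hWd (𝓕.𝓓 v) := rfl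

/-- **the finite half** `s_f := ⊗'_v s_v : H(𝔸_f) →* Mp(𝕎^𝔻)ᶜᵒⁿᵗ` (tree `finSplitting`).
[cite: GelbartRogawski1991, §3.1 Prop. 3.1.1 p. 455 L1–2] -/
def finHalf : HAf' →* MpD F e TV TW := (finSplittings F E c hcδ hδ hd e TV hV hVd TW hW hWd χ 𝔪 𝓕).finSplitting

/-! ##### (d) the local implementers of `δ`, normalised to fix `1_{𝒪_vᴺ}` almost everywhere -/

/-- the datum's implementer `r_v(δ_v)` implements the rational element `δ` read at `v`.
[cite: GelbartRogawski1991, §3.1 Prop. 3.1.1 p. 455 L1–2] -/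
theorem rDeltaAt_implements (v : HeightOneSpectrum (𝓞 F)) :
    Implements (localSchrodinger F (n + n) (gramD F e TV TW) v)
      (ofSymplectic _ (ratSpLoc F (n + n) (gramD F e TV TW) (isUnit_det_gramD F e TV hVd TW hWd) v (deltaD F)))
      (rDeltaAt F E c hcδ hδ hd e TV hV hVd TW hW hWd (𝓕.𝓓 v)) := by
  letI := (𝔪 v).mS; haveI := (𝔪 v).isBorel; haveI := (𝔪 v).isHaar
  exact (𝓕.𝓓 v).r.implements (deltaLoc F e TV hVd TW hWd v)

/-- the normalising scalar at `v`: `r_v(δ_v) 1_{𝒪_vᴺ} = c_v 1_{𝒪_vᴺ}` when such a `c_v` exists, else `1`.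
[cite: GelbartRogawski1991, §3.1 Prop. 3.1.1 p. 455 L1–2] -/
def deltaScalar (v : HeightOneSpectrum (𝓞 F)) : ℂˣ :=
  if h : ∃ a : ℂˣ, rDeltaAt F E c hcδ hδ hd e TV hV hVd TW hW hWd (𝓕.𝓓 v) (unitVec F (Fin (n + n)) v) =
      (a : ℂ) • unitVec F (Fin (n + n)) v then Classical.choose h else 1

/-- **the normalised local implementer `M_v := c_v⁻¹ r_v(δ_v)`.**
[cite: GelbartRogawski1991, §3.1 Prop. 3.1.1 p. 455 L1–2] -/
def deltaImpl (v : HeightOneSpectrum (𝓞 F)) :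
    SchwartzBruhat (Fin (n + n) → v.adicCompletion F) ≃ₗ[ℂ] SchwartzBruhat (Fin (n + n) → v.adicCompletion F) :=
  (rDeltaAt F E c hcδ hδ hd e TV hV hVd TW hW hWd (𝓕.𝓓 v)).trans
    (LinearEquiv.smulOfUnit (deltaScalar F E c hcδ hδ hd e TV hV hVd TW hW hWd χ 𝔪 𝓕 v)⁻¹)

/-- formula. [cite: GelbartRogawski1991, §3.1 Prop. 3.1.1 p. 455 L1–2] -/
theorem deltaImpl_apply (v : HeightOneSpectrum (𝓞 F)) (φ : SchwartzBruhat (Fin (n + n) → v.adicCompletion F)) :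
    deltaImpl F E c hcδ hδ hd e TV hV hVd TW hW hWd χ 𝔪 𝓕 v φ =
      (((deltaScalar F E c hcδ hδ hd e TV hV hVd TW hW hWd χ 𝔪 𝓕 v)⁻¹ : ℂˣ) : ℂ) • rDeltaAt F E c hcδ hδ hd e TV hV hVd TW hW hWd (𝓕.𝓓 v) φ := rfl

/-- formula for the inverse. [cite: GelbartRogawski1991, §3.1 Prop. 3.1.1 p. 455 L1–2] -/
theorem deltaImpl_symm_apply (v : HeightOneSpectrum (𝓞 F)) (φ : SchwartzBruhat (Fin (n + n) → v.adicCompletion F)) :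
    (deltaImpl F E c hcδ hδ hd e TV hV hVd TW hW hWd χ 𝔪 𝓕 v).symm φ =
      (rDeltaAt F E c hcδ hδ hd e TV hV hVd TW hW hWd (𝓕.𝓓 v)).symm (((deltaScalar F E c hcδ hδ hd e TV hV hVd TW hW hWd χ 𝔪 𝓕 v : ℂˣ) : ℂ) • φ) := by
  change (rDeltaAt F E c hcδ hδ hd e TV hV hVd TW hW hWd (𝓕.𝓓 v)).symm
    (((((deltaScalar F E c hcδ hδ hd e TV hV hVd TW hW hWd χ 𝔪 𝓕 v)⁻¹)⁻¹ : ℂˣ) : ℂ) • φ) = _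
  rw [inv_inv]

/-- the normalised implementer still implements `δ_v`. [cite: GelbartRogawski1991, §3.1 Prop. 3.1.1 p. 455 L1–2] -/
theorem deltaImpl_implements (v : HeightOneSpectrum (𝓞 F)) :
    Implements (localSchrodinger F (n + n) (gramD F e TV TW) v)
      (ofSymplectic _ (ratSpLoc F (n + n) (gramD F e TV TW) (isUnit_det_gramD F e TV hVd TW hWd) v (deltaD F)))
      (deltaImpl F E c hcδ hδ hd e TV hV hVd TW hW hWd χ 𝔪 𝓕 v) := by
  intro h φ
  rw [deltaImpl_apply, deltaImpl_apply, map_smul, rDeltaAt_implements F E c hcδ hδ hd e TV hV hVd TW hW hWd χ 𝔪 𝓕 v h φ]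

/-- **the normalised implementers fix `1_{𝒪_vᴺ}` for almost all `v`** (tree `eventually_exists_smul_unitVec`).
[cite: GelbartRogawski1991, §3.1 Prop. 3.1.1 p. 455 L1–2] -/
theorem eventually_deltaImpl_unitVec :
    ∀ᶠ v in Filter.cofinite, deltaImpl F E c hcδ hδ hd e TV hV hVd TW hW hWd χ 𝔪 𝓕 v (unitVec F (Fin (n + n)) v) =
      unitVec F (Fin (n + n)) v := by
  refine (eventually_exists_smul_unitVec F (n + n) (gramD F e TV TW) (isUnit_det_gramD F e TV hVd TW hWd)
    (deltaD F) (hU_family F E c hcδ hδ hd e TV hV hVd TW hW hWd χ 𝔪 𝓕)).mono fun v hv => ?_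
  have h : ∃ a : ℂˣ, rDeltaAt F E c hcδ hδ hd e TV hV hVd TW hW hWd (𝓕.𝓓 v) (unitVec F (Fin (n + n)) v) =
      (a : ℂ) • unitVec F (Fin (n + n)) v := hv _ (rDeltaAt_implements F E c hcδ hδ hd e TV hV hVd TW hW hWd χ 𝔪 𝓕 v)
  have key : ∀ a : ℂˣ, rDeltaAt F E c hcδ hδ hd e TV hV hVd TW hW hWd (𝓕.𝓓 v) (unitVec F (Fin (n + n)) v) =
      (a : ℂ) • unitVec F (Fin (n + n)) v →
      (((a⁻¹ : ℂˣ)) : ℂ) • rDeltaAt F E c hcδ hδ hd e TV hV hVd TW hW hWd (𝓕.𝓓 v) (unitVec F (Fin (n + n)) v) =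
        unitVec F (Fin (n + n)) v := fun a ha => by
    rw [ha, smul_smul, ← Units.val_mul, inv_mul_cancel, Units.val_one, one_smul]
  rw [deltaImpl_apply]
  unfold deltaScalar
  rw [dif_pos h]
  exact key _ (Classical.choose_spec h)

/-- conjugation is blind to the normalising scalar: `M_v X M_v⁻¹ φ = r_v(δ) X r_v(δ)⁻¹ φ` for linear `X`.
[cite: GelbartRogawski1991, §3.1 Prop. 3.1.1 p. 455 L1–2] -/
theorem deltaImpl_conj (v : HeightOneSpectrum (𝓞 F))
    (X : SchwartzBruhat (Fin (n + n) → v.adicCompletion F) →ₗ[ℂ] SchwartzBruhat (Fin (n + n) → v.adicCompletion F))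
    (φ : SchwartzBruhat (Fin (n + n) → v.adicCompletion F)) :
    deltaImpl F E c hcδ hδ hd e TV hV hVd TW hW hWd χ 𝔪 𝓕 v (X ((deltaImpl F E c hcδ hδ hd e TV hV hVd TW hW hWd χ 𝔪 𝓕 v).symm φ)) =
      rDeltaAt F E c hcδ hδ hd e TV hV hVd TW hW hWd (𝓕.𝓓 v) (X ((rDeltaAt F E c hcδ hδ hd e TV hV hVd TW hW hWd (𝓕.𝓓 v)).symm φ)) := by
  rw [deltaImpl_symm_apply, deltaImpl_apply, map_smul, map_smul, map_smul, smul_smul, ← Units.val_mul, inv_mul_cancel,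
    Units.val_one, one_smul]

/-! ##### (e) the parabolic prescription of the finite half; `IsFinHalf` -/

/-- the local prescription (the field `parabolicNormalised v`) for the NORMALISED implementers, in the shape consumed by the
tree's `conjOp_apply_zero`. [cite: GelbartRogawski1991, §3.1 Prop. 3.1.1 p. 455 L1–2] -/
theorem finHalf_hloc (v : HeightOneSpectrum (𝓞 F)) (u : LocPi' v)
    (hu : IsSiegelDelta F E c e TV TW (locToAdelic F E c e TV TW v u))
    (φ : SchwartzBruhat (Fin (n + n) → v.adicCompletion F)) :
    ((deltaImpl F E c hcδ hδ hd e TV hV hVd TW hW hWd χ 𝔪 𝓕 v ((finSplittings F E c hcδ hδ hd e TV hV hVd TW hW hWd χ 𝔪 𝓕).omegaLoc v u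
        ((deltaImpl F E c hcδ hδ hd e TV hV hVd TW hW hWd χ 𝔪 𝓕 v).symm φ)) : SchwartzBruhat (Fin (n + n) → v.adicCompletion F)) :
          (Fin (n + n) → v.adicCompletion F) → ℂ) 0 =
      (((chiDet F E c e TV TW χ (finToA' (inclP' v u)) : ℂˣ) : ℂ) * (modDelta F E c e TV TW (finToA' (inclP' v u)) : ℂ)) *
        ((φ : SchwartzBruhat (Fin (n + n) → v.adicCompletion F)) : (Fin (n + n) → v.adicCompletion F) → ℂ) 0 := by
  rw [deltaImpl_conj F E c hcδ hδ hd e TV hV hVd TW hW hWd χ 𝔪 𝓕 v ((finSplittings F E c hcδ hδ hd e TV hV hVd TW hW hWd χ 𝔪 𝓕).omegaLoc v u) φ]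
  exact 𝓕.parabolicNormalised v u hu (isUnit_detDelta_of_isSiegelDelta F E c e TV TW _ hu) φ

/-- `opD (r_F^𝔻(δ) · s_f(g) · r_F^𝔻(δ)⁻¹) Φ` is the tree's `conjOp` applied to `Φ` (definitional bookkeeping).
[cite: GelbartRogawski1991, §3.1 Prop. 3.1.1 p. 455 L1–2] -/
theorem opD_conj_finHalf (g : HAf') (Φ : piSchwartzBruhat F (Fin (n + n))) :
    opD F e TV TW (rDelta F e TV hVd TW hWd * finHalf F E c hcδ hδ hd e TV hV hVd TW hW hWd χ 𝔪 𝓕 g *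
        (rDelta F e TV hVd TW hWd)⁻¹) Φ =
      ((conjOp (gramD F e TV TW) (finSplittings F E c hcδ hδ hd e TV hV hVd TW hW hWd χ 𝔪 𝓕)
          (MpPsi.toOp _ ((rDelta F e TV hVd TW hWd : MpD F e TV TW) :
            adelicMp F (Fin (n + n)) (gramDA F e TV TW))) g Φ : piSchwartzBruhat F (Fin (n + n))) :
        (Fin (n + n) → AdeleRing (𝓞 F) F) → ℂ) := rfl

/-- the symplectic component of `r_F^𝔻(δ)` is the rational element `δ` read in `Sp(𝕎^𝔻_𝔸)` (tree `proj_coe_ratThetaLiftCont`).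
[cite: GelbartRogawski1991, §3.1 Prop. 3.1.1 p. 455 L1–2] -/
theorem fst_rDelta_eq_ratSp :
    (((rDelta F e TV hVd TW hWd : MpD F e TV TW) : adelicMp F (Fin (n + n)) (gramDA F e TV TW)) :
        symplecticGroup (polar (adelicForm F (Fin (n + n)) (gramDA F e TV TW))) ×
          (piSchwartzBruhat F (Fin (n + n)) ≃ₗ[ℂ] piSchwartzBruhat F (Fin (n + n)))).1 =
      ratSp F ((gramD F e TV TW).map (algebraMap F (AdeleRing (𝓞 F) F)))
        (isUnit_det_gramAdele F (n + n) (gramD F e TV TW) (isUnit_det_gramD F e TV hVd TW hWd)) (deltaD F) :=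
  proj_coe_ratThetaLiftCont (F := F) (T := gramDA F e TV TW) (hT := isUnit_det_gramDA F e TV hVd TW hWd) (deltaD F)

set_option maxHeartbeats 800000 in
/-- **THE PARABOLIC PRESCRIPTION OF THE FINITE HALF** (tree `conjOp_apply_zero` at `P_v := P_Δ`, `λ := χ(det_Δ)|det_Δ|^{1/2}`,
`M_v :=` the normalised `r_v(δ_v)`; the single-place input is the field `parabolicNormalised v`).
[cite: GelbartRogawski1991, §3.1 Prop. 3.1.1 p. 455 L1–2] -/
theorem finHalf_parabolic :
    ParabolicPrescribed F E c e TV hVd TW hWd finToA' χ (finHalf F E c hcδ hδ hd e TV hV hVd TW hW hWd χ 𝔪 𝓕) := by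
  intro g hg _ Φ
  obtain ⟨A, hA⟩ := exists_arch_tmul (gramD F e TV TW) (isUnit_det_gramD F e TV hVd TW hWd) (deltaD F)
    (deltaImpl F E c hcδ hδ hd e TV hV hVd TW hW hWd χ 𝔪 𝓕) (deltaImpl_implements F E c hcδ hδ hd e TV hV hVd TW hW hWd χ 𝔪 𝓕)
    (eventually_deltaImpl_unitVec F E c hcδ hδ hd e TV hV hVd TW hW hWd χ 𝔪 𝓕)
    ((rDelta F e TV hVd TW hWd : MpD F e TV TW) : adelicMp F (Fin (n + n)) (gramDA F e TV TW))
    (rDelta F e TV hVd TW hWd).2 (fst_rDelta_eq_ratSp F e TV hVd TW hWd)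
  have key := conjOp_apply_zero (gramD F e TV TW) (finSplittings F E c hcδ hδ hd e TV hV hVd TW hW hWd χ 𝔪 𝓕)
    (deltaImpl F E c hcδ hδ hd e TV hV hVd TW hW hWd χ 𝔪 𝓕) (eventually_deltaImpl_unitVec F E c hcδ hδ hd e TV hV hVd TW hW hWd χ 𝔪 𝓕)
    (fun Φinf f => (hA Φinf f).1) (fun Φinf f => (hA Φinf f).2)
    (fun v u => IsSiegelDelta F E c e TV TW (locToAdelic F E c e TV TW v u))
    (fun v => by rw [map_one]; exact isSiegelDelta_one' F E c e TV TW)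
    (fun g => ((chiDet F E c e TV TW χ (finToA' g) : ℂˣ) : ℂ) * (modDelta F E c e TV TW (finToA' g) : ℂ))
    (fun g g' hg hg' => by
      have hS := (isSiegelDelta_finToA_iff_forall_place F E c e TV TW g).2 hg
      have hS' := (isSiegelDelta_finToA_iff_forall_place F E c e TV TW g').2 hg'
      have h1 : chiDet F E c e TV TW χ (finToA' (g * g')) =
          chiDet F E c e TV TW χ (finToA' g) * chiDet F E c e TV TW χ (finToA' g') := by
        rw [← chiDet_mul F E c e TV TW χ hS hS']; exact congrArg _ (map_mul _ g g')
      have h2 : modDelta F E c e TV TW (finToA' (g * g')) =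
          modDelta F E c e TV TW (finToA' g) * modDelta F E c e TV TW (finToA' g') := by
        rw [← modDelta_mul F E c e TV TW hS hS']; exact congrArg _ (map_mul _ g g')
      change ((chiDet F E c e TV TW χ (finToA' (g * g')) : ℂˣ) : ℂ) * (modDelta F E c e TV TW (finToA' (g * g')) : ℂ) = _
      rw [h1, h2, Units.val_mul, Complex.ofReal_mul]
      ring)
    (by
      have h1 : chiDet F E c e TV TW χ (finToA' 1) = 1 := by
        rw [← chiDet_one' F E c e TV TW χ]; exact congrArg _ (map_one _)
      have h2 : modDelta F E c e TV TW (finToA' 1) = 1 := by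
        rw [← modDelta_one' F E c e TV TW]; exact congrArg _ (map_one _)
      change ((chiDet F E c e TV TW χ (finToA' 1) : ℂˣ) : ℂ) * (modDelta F E c e TV TW (finToA' 1) : ℂ) = 1
      rw [h1, h2, Units.val_one, Complex.ofReal_one, mul_one])
    ((continuousOn_chiDet_modDelta F E c e TV TW χ).mono fun g hg =>
      (isSiegelDelta_finToA_iff_forall_place F E c e TV TW g).2 hg)
    (fun v u hu φ => finHalf_hloc F E c hcδ hδ hd e TV hV hVd TW hW hWd χ 𝔪 𝓕 v u hu φ)
    g ((isSiegelDelta_finToA_iff_forall_place F E c e TV TW g).1 hg) Φ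
  rw [opD_conj_finHalf]
  exact key

/-- **`s_f` IS A FINITE HALF**: continuous, over `ι^𝔻`, finite operators, parabolic-prescribed.
[cite: GelbartRogawski1991, §3.1 Prop. 3.1.1 p. 455 L1–2] -/
theorem finHalf_isFinHalf : IsFinHalf F E c hcδ hδ hd e TV hV hVd TW hW hWd χ (finHalf F E c hcδ hδ hd e TV hV hVd TW hW hWd χ 𝔪 𝓕) where
  continuous := (finSplittings F E c hcδ hδ hd e TV hV hVd TW hW hWd χ 𝔪 𝓕).continuous_finSplitting
  proj_eq g := (finSplittings F E c hcδ hδ hd e TV hV hVd TW hW hWd χ 𝔪 𝓕).proj_finSplitting g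
  isFinite g := (finSplittings F E c hcδ hδ hd e TV hV hVd TW hW hWd χ 𝔪 𝓕).exists_omega_finSplitting_eq g
  parabolic := finHalf_parabolic F E c hcδ hδ hd e TV hV hVd TW hW hWd χ 𝔪 𝓕

/-- **S1fin-asm**: a per-place family yields a finite half.
[cite: GelbartRogawski1991, §3.1 Prop. 3.1.1 p. 455 L1–2] -/
theorem S1fin_asm (χ : HeckeCharacter E) (𝔪 : ∀ v, PlaceMeasure F v) (𝓕 : FinLocalFamily F E c hcδ hδ hd e TV hV hVd TW hW hWd χ 𝔪) :
    ∃ sf, IsFinHalf F E c hcδ hδ hd e TV hV hVd TW hW hWd χ sf :=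
  ⟨_, finHalf_isFinHalf F E c hcδ hδ hd e TV hV hVd TW hW hWd χ 𝔪 𝓕⟩

end Family

end S1finAsm

end Literature.NumberTheory.GelbartRogawski1991.GRConstructionGen
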